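import Mathlib
import Summits.QuantumFields.YangMills.Theorems.BalabanLadderIRTwistedSlabHessian
import HarnessLib

/-!
# The twisted Wilson action of the `Fin` box in the EXPONENTIAL CHART `a ↦ (e^{a_μ(x)} U(x,μ))`: smoothness (real analyticity of
# the matrix exponential), the line restriction is `lineAction`, criticality on `su(N)`-valued directions, and the Coulomb-gauge
# Hessian gap read through the chart

HELPER toward stub **T1** `TwistedSlabAnchor` (LINE `twisted-slab-continuity`, crux `IRcof` stmt-QuantumFields-26930, census row 43;
LEAD prover ym-ir-line-tsc-p1 g3; `--supports` the crux, `--as helper`).  First brick of the roadmap item M1 («slice ∕ tubular on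
`SU(N)^E`», T1-ANATOMY §9.3 (4)) that is pure calculus: the REGULARITY hypothesis of every Laplace-type asymptotic
(`Literature.Analysis.Asymptotics.tendsto_laplaceMethod_of_hasFDerivAt`, `tendsto_laplaceMethod_fibred`) for the T1 integrand's exponent,
in T1's currency.
* §1 `chartAction U c a = Σ_x Σ_{μ<ν} (N − Re tr(c_x(μ,ν) · P_{e^{a}U}(x;μ,ν)))` — the twisted Wilson action of the box as a function of the
  fluctuation `a : Fin 4 → FinTorusSite → M_N(ℂ)` in the exponential chart at the background `U`; `chartAction_smul`:
  `chartAction U c (t • a) = lineAction U a c t` (the line restriction IS `…TwistedSlabHessian.lineAction`); `chartAction_zero` at an eater.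
* §2 ★ `contDiff_chartAction`: `chartAction U c` is `C^∞` (`ContDiff ℝ ⊤`) on the whole fluctuation space, for EVERY background and all
  twist phases — from the real analyticity of the matrix exponential (`NormedSpace.exp_analytic`) in the Frobenius-normed algebra
  `M_N(ℂ)` (Mathlib's scoped `Matrix.Norms.Frobenius` instances; `‖X‖² = S(X) = Re tr(XᴴX)` there, the Hilbert–Schmidt mass of K3),
  products, `star` (`starL'`), trace and real part.
* §3 ★ `lineDeriv_chartAction_zero` ∕ `fderiv_chartAction_zero_apply_eq_zero`: at a unitary background EATING the twist phases the
  differential of `chartAction U c` at `a = 0` VANISHES on every skew-Hermitian direction (critical point of the restriction to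
  `𝔲(N)^E`, the tangent space of the link group; on non-skew directions it need not vanish — they leave the group);
  ★★ `iteratedDeriv_two_chartAction_line` (`= Σ_x Σ_{μ<ν} S(∇⁺_μ a_ν − ∇⁺_ν a_μ)`) and ★★ `chartAction_line_hessian_gap_ladder`: the
  Coulomb-gauge gap `4 sin²(π/(N(m+1)))` of K3 read through the chart at the decorated twist-eating ladders, uniformly in the long extents.
NOT here: the joint second-order expansion `chartAction(a) = ½ Q(a) + o(‖a‖²)` with the Hessian as a bilinear form on a chosen inner-product
model of `su(N)^E` (next: `isLittleO_taylor_two` + `iteratedDeriv_two_along_line` from lit-4's Laplace files, once the consumer fixes the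
Hilbert structure), the Haar density in the chart, the Jacobian of the slice (M1 proper), anything uniform in `β` (M3), the cluster
expansion (M4).

HONEST FRAMING: calculus on one box; T1-box 0∕1, T1 proper 0∕1; nothing here bears on `IRcof`, `IR`, or the Yang–Mills mass gap (Clay:
NOT proved); R4 = `BalabanLadder.UV` only.  References: M. García Pérez, A. González-Arroyo, M. Okawa, JHEP 10 (2017) 150 §2.3 (exponential
parametrisation `U_μ = e^{−igA_μ}Γ_μ` of the links around the twist eater); K. W. Breitung, *Asymptotic Approximations for Probability
Integrals*, LNM 1592 (1994), Thm 41 (regularity hypotheses of Laplace's method).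
-/

set_option autoImplicit false

noncomputable section

open scoped Matrix Matrix.Norms.Frobenius
open Finset NormedSpace
open Literature.MathematicalPhysics.QuantumFieldTheory Literature.MathematicalPhysics.QuantumLattice
open Literature.MathematicalPhysics.QuantumLattice.WilsonSecondVariation

namespace Summit.QuantumFields.YangMills.Cruxes.IRcof.TwistedSlab

variable {N : ℕ} {n₀ n₁ n₂ n₃ : ℕ}

/-! ## §1 The action in the exponential chart and its line restriction -/

section Chart

variable (U : FinTorusSite n₀ n₁ n₂ n₃ × Fin 4 → Matrix (Fin N) (Fin N) ℂ)
  (c : FinTorusSite n₀ n₁ n₂ n₃ → Fin 4 → Fin 4 → ℂ)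

/-- The plaquette of the chart links `e^{a_μ(x)} U(x,μ)` at `(x; μ, ν)`. [cite: GarciaperezGonzalezarroyoOkawa2017, §2.3 (2.3)] -/
def chartPlaq (a : Fin 4 → FinTorusSite n₀ n₁ n₂ n₃ → Matrix (Fin N) (Fin N) ℂ) (x : FinTorusSite n₀ n₁ n₂ n₃) (μ ν : Fin 4) :
    Matrix (Fin N) (Fin N) ℂ :=
  exp (a μ x) * U (x, μ) * (exp (a ν (x.shift μ)) * U (x.shift μ, ν)) * (exp (a μ (x.shift ν)) * U (x.shift ν, μ))ᴴ *
    (exp (a ν x) * U (x, ν))ᴴ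

/-- **The twisted Wilson action of the box in the exponential chart at `U`**: `Σ_x Σ_{μ<ν} (N − Re tr(c_x(μ,ν) · P_{e^{a}U}(x; μ, ν)))`.
[cite: tHooft1979Flux, §2 (2.6)] [cite: GarciaperezGonzalezarroyoOkawa2017, §2.1–2.3] -/
def chartAction (a : Fin 4 → FinTorusSite n₀ n₁ n₂ n₃ → Matrix (Fin N) (Fin N) ℂ) : ℝ :=
  ∑ x, ∑ q : {q : Fin 4 × Fin 4 // q.1 < q.2}, ((N : ℝ) - (c x q.1.1 q.1.2 • chartPlaq U a x q.1.1 q.1.2).trace.re)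

/-- **The line restriction of the chart action is `lineAction`**: `chartAction U c (t • a) = lineAction U a c t`. [folklore] -/
theorem chartAction_smul (a : Fin 4 → FinTorusSite n₀ n₁ n₂ n₃ → Matrix (Fin N) (Fin N) ℂ) (t : ℝ) :
    chartAction U c (t • a) = lineAction U a c t := by
  simp only [chartAction, lineAction, chartPlaq, linePlaq, plaqHol, Pi.smul_apply]

/-- The line restriction as functions of `t`. [folklore] -/
theorem chartAction_comp_smul (a : Fin 4 → FinTorusSite n₀ n₁ n₂ n₃ → Matrix (Fin N) (Fin N) ℂ) :
    (fun t : ℝ => chartAction U c (t • a)) = lineAction U a c :=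
  funext fun t => chartAction_smul U c a t

/-- At `a = 0` the chart action is the twisted action of the background; it VANISHES when `U` eats the phases `c`.
[cite: GarciaperezGonzalezarroyoOkawa2017, §2.2] -/
theorem chartAction_zero (hc : ∀ x μ ν, star (c x μ ν) * c x μ ν = 1)
    (heat : ∀ (x : FinTorusSite n₀ n₁ n₂ n₃) (μ ν : Fin 4), μ < ν → bgPlaq U x μ ν = star (c x μ ν) • (1 : Matrix (Fin N) (Fin N) ℂ))
    (a : Fin 4 → FinTorusSite n₀ n₁ n₂ n₃ → Matrix (Fin N) (Fin N) ℂ) :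
    chartAction U c 0 = 0 := by
  rw [show (0 : Fin 4 → FinTorusSite n₀ n₁ n₂ n₃ → Matrix (Fin N) (Fin N) ℂ) = (0 : ℝ) • a by rw [zero_smul], chartAction_smul]
  exact lineAction_zero hc heat

end Chart

/-! ## §2 Smoothness in the chart -/

section Smooth

variable (U : FinTorusSite n₀ n₁ n₂ n₃ × Fin 4 → Matrix (Fin N) (Fin N) ℂ)
  (c : FinTorusSite n₀ n₁ n₂ n₃ → Fin 4 → Fin 4 → ℂ)

/-- Evaluation `a ↦ a μ x` is a continuous linear map, hence smooth. [folklore] -/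
theorem contDiff_eval (μ : Fin 4) (x : FinTorusSite n₀ n₁ n₂ n₃) :
    ContDiff ℝ ⊤ (fun a : Fin 4 → FinTorusSite n₀ n₁ n₂ n₃ → Matrix (Fin N) (Fin N) ℂ => a μ x) :=
  contDiff_apply_apply ℝ (Matrix (Fin N) (Fin N) ℂ) (n := ⊤) μ x

/-- **The matrix exponential of an evaluation is smooth** (real analyticity of `exp` on the complete normed algebra `M_N(ℂ)`).
[folklore] -/
theorem contDiff_exp_eval (μ : Fin 4) (x : FinTorusSite n₀ n₁ n₂ n₃) :
    ContDiff ℝ ⊤ (fun a : Fin 4 → FinTorusSite n₀ n₁ n₂ n₃ → Matrix (Fin N) (Fin N) ℂ => exp (a μ x)) := by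
  have h : AnalyticOnNhd ℝ (fun Y : Matrix (Fin N) (Fin N) ℂ => exp Y) Set.univ := fun X _ => NormedSpace.exp_analytic X
  exact h.contDiff.comp (contDiff_eval μ x)

/-- `star = ᴴ` is smooth (a real-linear isometry). [folklore] -/
theorem contDiff_conjTranspose : ContDiff ℝ ⊤ (fun M : Matrix (Fin N) (Fin N) ℂ => Mᴴ) :=
  (starL' ℝ : Matrix (Fin N) (Fin N) ℂ ≃L[ℝ] Matrix (Fin N) (Fin N) ℂ).contDiff

/-- **Each chart plaquette is a smooth function of the fluctuation.** [folklore] -/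
theorem contDiff_chartPlaq (x : FinTorusSite n₀ n₁ n₂ n₃) (μ ν : Fin 4) :
    ContDiff ℝ ⊤ (fun a : Fin 4 → FinTorusSite n₀ n₁ n₂ n₃ → Matrix (Fin N) (Fin N) ℂ => chartPlaq U a x μ ν) := by
  unfold chartPlaq
  have h1 : ContDiff ℝ ⊤ (fun a : Fin 4 → FinTorusSite n₀ n₁ n₂ n₃ → Matrix (Fin N) (Fin N) ℂ => exp (a μ x) * U (x, μ)) :=
    ContDiff.mul (contDiff_exp_eval μ x) contDiff_const
  have h2 : ContDiff ℝ ⊤ (fun a : Fin 4 → FinTorusSite n₀ n₁ n₂ n₃ → Matrix (Fin N) (Fin N) ℂ => exp (a ν (x.shift μ)) * U (x.shift μ, ν)) :=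
    ContDiff.mul (contDiff_exp_eval ν (x.shift μ)) contDiff_const
  have h3 : ContDiff ℝ ⊤ (fun a : Fin 4 → FinTorusSite n₀ n₁ n₂ n₃ → Matrix (Fin N) (Fin N) ℂ => (exp (a μ (x.shift ν)) * U (x.shift ν, μ))ᴴ) :=
    contDiff_conjTranspose.comp (ContDiff.mul (contDiff_exp_eval μ (x.shift ν)) contDiff_const)
  have h4 : ContDiff ℝ ⊤ (fun a : Fin 4 → FinTorusSite n₀ n₁ n₂ n₃ → Matrix (Fin N) (Fin N) ℂ => (exp (a ν x) * U (x, ν))ᴴ) :=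
    contDiff_conjTranspose.comp (ContDiff.mul (contDiff_exp_eval ν x) contDiff_const)
  exact ContDiff.mul (ContDiff.mul (ContDiff.mul h1 h2) h3) h4

/-- ★ **The twisted Wilson action of the box is `C^∞` in the exponential chart** — for every background `U` and all phases `c`.
[cite: Breitung1994, Thm 41 (regularity hypotheses of Laplace's method)] -/
theorem contDiff_chartAction : ContDiff ℝ ⊤ (chartAction U c) := by
  have htr : ContDiff ℝ ⊤ (fun M : Matrix (Fin N) (Fin N) ℂ => M.trace) :=
    ((Matrix.traceLinearMap (Fin N) ℂ ℂ).restrictScalars ℝ).toContinuousLinearMap.contDiff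
  have hre : ContDiff ℝ ⊤ (fun z : ℂ => z.re) := Complex.reCLM.contDiff
  unfold chartAction
  refine ContDiff.sum fun x _ => ContDiff.sum fun q _ => ?_
  exact contDiff_const.sub (hre.comp (htr.comp ((contDiff_chartPlaq U x q.1.1 q.1.2).const_smul (c x q.1.1 q.1.2))))

/-- The chart action is differentiable everywhere (from `C^∞`). [folklore] -/
theorem differentiable_chartAction : Differentiable ℝ (chartAction U c) :=
  (contDiff_chartAction U c).differentiable WithTop.top_ne_zero

end Smooth

/-! ## §3 Criticality on skew directions and the Hessian gap, read through the chart -/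

section Critical

variable {U : FinTorusSite n₀ n₁ n₂ n₃ × Fin 4 → Matrix (Fin N) (Fin N) ℂ} {c : FinTorusSite n₀ n₁ n₂ n₃ → Fin 4 → Fin 4 → ℂ}
  {a : Fin 4 → FinTorusSite n₀ n₁ n₂ n₃ → Matrix (Fin N) (Fin N) ℂ}

/-- The line derivative of the chart action at `0` in the direction `a` is the derivative of `lineAction` at `0`. [folklore] -/
theorem lineDeriv_chartAction_zero (U : FinTorusSite n₀ n₁ n₂ n₃ × Fin 4 → Matrix (Fin N) (Fin N) ℂ)
    (c : FinTorusSite n₀ n₁ n₂ n₃ → Fin 4 → Fin 4 → ℂ) (a : Fin 4 → FinTorusSite n₀ n₁ n₂ n₃ → Matrix (Fin N) (Fin N) ℂ) :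
    lineDeriv ℝ (chartAction U c) 0 a = deriv (lineAction U a c) 0 := by
  unfold lineDeriv
  have e : (fun t : ℝ => chartAction U c ((0 : Fin 4 → FinTorusSite n₀ n₁ n₂ n₃ → Matrix (Fin N) (Fin N) ℂ) + t • a)) = lineAction U a c := by
    funext t
    rw [zero_add]
    exact chartAction_smul U c a t
  rw [e]

/-- ★ **Criticality of the twist eater in the chart, on skew-Hermitian directions**: at a unitary background eating the phases `c`, the
differential of `chartAction U c` at `a = 0` vanishes on every skew-Hermitian `a` (the tangent directions of the link group).
[cite: GarciaperezGonzalezarroyoOkawa2017, §2.2–2.3] -/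
theorem fderiv_chartAction_zero_apply_eq_zero (hU : ∀ e, U e ∈ Matrix.unitaryGroup (Fin N) ℂ)
    (hc : ∀ x μ ν, star (c x μ ν) * c x μ ν = 1)
    (heat : ∀ (x : FinTorusSite n₀ n₁ n₂ n₃) (μ ν : Fin 4), μ < ν → bgPlaq U x μ ν = star (c x μ ν) • (1 : Matrix (Fin N) (Fin N) ℂ))
    (hskew : ∀ μ x, (a μ x)ᴴ = -a μ x) :
    fderiv ℝ (chartAction U c) 0 a = 0 := by
  have h := (differentiable_chartAction U c 0).lineDeriv_eq_fderiv (v := a)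
  calc fderiv ℝ (chartAction U c) 0 a = lineDeriv ℝ (chartAction U c) 0 a := h.symm
    _ = deriv (lineAction U a c) 0 := lineDeriv_chartAction_zero U c a
    _ = 0 := deriv_lineAction_zero hU hc heat hskew

/-- ★★ **The second derivative along skew lines in the chart is the covariant curl form.** [cite: GarciaperezGonzalezarroyoOkawa2017, §2.3] -/
theorem iteratedDeriv_two_chartAction_line (hU : ∀ e, U e ∈ Matrix.unitaryGroup (Fin N) ℂ)
    (hc : ∀ x μ ν, star (c x μ ν) * c x μ ν = 1)
    (heat : ∀ (x : FinTorusSite n₀ n₁ n₂ n₃) (μ ν : Fin 4), μ < ν → bgPlaq U x μ ν = star (c x μ ν) • (1 : Matrix (Fin N) (Fin N) ℂ))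
    (hskew : ∀ μ x, (a μ x)ᴴ = -a μ x) :
    iteratedDeriv 2 (fun t : ℝ => chartAction U c (t • a)) 0 =
      ∑ x, ∑ q : {q : Fin 4 × Fin 4 // q.1 < q.2}, ((((covDeriv U q.1.1 (a q.1.2) x - covDeriv U q.1.2 (a q.1.1) x))ᴴ *
        (covDeriv U q.1.1 (a q.1.2) x - covDeriv U q.1.2 (a q.1.1) x)).trace).re := by
  rw [chartAction_comp_smul]
  exact iteratedDeriv_two_lineAction hU hc heat hskew

variable [NeZero N] {m : ℕ} {A B : Matrix (Fin N) (Fin N) ℂ} {ω : ℂ}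

/-- ★★ **The Coulomb-gauge Hessian gap in the chart at the decorated twist-eating ladders** (K3's `ladder_hessian_gap` read through
`chartAction`): `4 sin²(π/(N(m+1))) · Σ_x Σ_μ S(a_μ x) ≤ d²/dt²|₀ chartAction(t • a)` for traceless skew-Hermitian `a` with `div a = 0`,
uniformly in the long extents. [cite: GarciaperezGonzalezarroyoOkawa2017, §2.2, §2.5] [cite: GarciaperezGonzalezarroyoOkawa2014, §3] -/
theorem chartAction_line_hessian_gap_ladder {n₂' n₃' : ℕ} (hAu : A ∈ Matrix.unitaryGroup (Fin N) ℂ) (hBu : B ∈ Matrix.unitaryGroup (Fin N) ℂ)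
    (hω : IsPrimitiveRoot ω N) (hAB : A * B = ω • (B * A)) {c₂ c₃ : ℂ} (hc₂ : star c₂ * c₂ = 1) (hc₃ : star c₃ * c₃ = 1)
    {c : FinTorusSite (m + 1) (m + 1) n₂' n₃' → Fin 4 → Fin 4 → ℂ} (hc : ∀ x μ ν, star (c x μ ν) * c x μ ν = 1)
    (heat : ∀ (x : FinTorusSite (m + 1) (m + 1) n₂' n₃') (μ ν : Fin 4), μ < ν →
      bgPlaq (ladderField ![A, B, c₂ • (1 : Matrix (Fin N) (Fin N) ℂ), c₃ • (1 : Matrix (Fin N) (Fin N) ℂ)]) x μ ν =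
        star (c x μ ν) • (1 : Matrix (Fin N) (Fin N) ℂ))
    {a : Fin 4 → FinTorusSite (m + 1) (m + 1) n₂' n₃' → Matrix (Fin N) (Fin N) ℂ}
    (hskew : ∀ μ x, (a μ x)ᴴ = -a μ x) (htr : ∀ μ x, (a μ x).trace = 0)
    (hdiv : ∀ x, covDiv (ladderField ![A, B, c₂ • (1 : Matrix (Fin N) (Fin N) ℂ), c₃ • (1 : Matrix (Fin N) (Fin N) ℂ)]) a x = 0) :
    4 * Real.sin (Real.pi / ((N : ℝ) * (m + 1 : ℕ))) ^ 2 * ∑ x, ∑ μ, (((a μ x)ᴴ * a μ x).trace).re ≤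
      iteratedDeriv 2 (fun t : ℝ => chartAction (ladderField ![A, B, c₂ • (1 : Matrix (Fin N) (Fin N) ℂ),
        c₃ • (1 : Matrix (Fin N) (Fin N) ℂ)]) c (t • a)) 0 := by
  rw [chartAction_comp_smul]
  exact ladder_hessian_gap hAu hBu hω hAB hc₂ hc₃ hc heat hskew htr hdiv

end Critical

/-! ## §4 The Frobenius norm of the chart is the Hilbert–Schmidt mass of K3 -/

section Frobenius

/-- In the Frobenius-normed algebra `M_N(ℂ)`: `‖X‖² = S(X) = Re tr(XᴴX)` — the norm of the chart coordinates is the Hilbert–Schmidt mass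
in which K3's gap is stated. [folklore] -/
theorem frobenius_norm_sq_eq_hsS (X : Matrix (Fin N) (Fin N) ℂ) : ‖X‖ ^ 2 = ((Xᴴ * X).trace).re := by
  rw [re_trace_conjTranspose_mul_self_eq_sum, Matrix.frobenius_norm_def, ← Real.rpow_natCast,
    ← Real.rpow_mul (Finset.sum_nonneg fun i _ => Finset.sum_nonneg fun j _ => by positivity)]
  norm_num

end Frobenius

end Summit.QuantumFields.YangMills.Cruxes.IRcof.TwistedSlab

end
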